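import Summits.Parity.GeneralizedHardyLittlewood.Theorems.LeeYangFibresRelativeDimOneSplitDictionary
import Summits.Parity.GeneralizedHardyLittlewood.Theorems.LeeYangFibresRelativeDimOneSplitLocalIdentity
import Mathlib.Data.Int.CardIntervalMod
import HarnessLib

/-!
# Counting on box-cosets (crux stmt-Parity-14113 `LeeYangFibres.RelativeDimOne`, line
gallagher-backwards-split, stub `stub_inversion`, PIECE 3b)

Elementary counts entering the coset discrepancy (hypothesis (A) of `IncidenceRigidity` for the
difference of the core spectrum and the singular-series spectrum):
* a progression meets `[u, u + X]` in `(X+1)/q ± 1` points (`card_Icc_filter_modEq_bounds`), so the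
  coset `C = B ∩ (c + qℤ^t)` of the box `B = ∏ [u_i, u_i + X_i]` has `#C = ∏_i #C_i`
  (`card_coset_box`) with `|#C − ∏_i (X_i+1)/q^t| ≤ t 2^t (q/D) ∏_i (X_i+1)/q^t` whenever
  `q ≤ D ≤ X_i + 1` (`abs_card_coset_box_sub_le`, via the product perturbation lemma
  `abs_prod_sub_prod_le`);
* the window count `#{n < W : ∀ i, gcd(a_i n + c_i, q) = 1}` is `W/q · #{r < q : …} ± q`
  (`abs_card_window_coprime_sub_le`);
* `MovingClassMoments` restated with the window count over `n : ℕ` (`movingClassMoments_nat`; in the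
  registered statement the count is elaborated over the monadic image of `range W` in `Finset ℤ`);
* the crude bound `Σ_{n<W} ∏_i Λ(a_i n + b_i) ≤ W (log M)^t` when all `|a_i n + b_i| ≤ M`
  (`window_sum_le`).
-/

noncomputable section

open scoped BigOperators Classical Topology ArithmeticFunction.vonMangoldt
open Finset Filter MeasureTheory Literature.NumberTheory.Sieve
open Summit.Parity.GeneralizedHardyLittlewood.Cruxes.RelativeDimOne.GallagherBackwards (classPsi)

namespace Summit.Parity.GeneralizedHardyLittlewood.Cruxes.RelativeDimOne.GallagherBackwardsSplit

variable {t : ℕ}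

/-! ### One progression in an interval -/

/-- A residue class mod `q ≥ 1` meets `[u, u + X]` in `n` points with
`(X+1)/q − 1 < n < (X+1)/q + 1`. -/
theorem card_Icc_filter_modEq_bounds {q : ℕ} (hq : 0 < q) (u c : ℤ) (X : ℕ) :
    ((X : ℝ) + 1) / q - 1 < (((Icc u (u + X)).filter (fun x => Int.ModEq q x c)).card : ℝ) ∧
      (((Icc u (u + X)).filter (fun x => Int.ModEq q x c)).card : ℝ) < ((X : ℝ) + 1) / q + 1 := by
  have hI : Icc u (u + X) = Ico u (u + X + 1) := by
    ext x
    simp only [mem_Icc, mem_Ico]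
    omega
  rw [hI]
  have hq' : (0 : ℤ) < (q : ℤ) := by exact_mod_cast hq
  have h := Int.Ico_filter_modEq_card u (u + X + 1) (r := (q : ℤ)) hq' c
  set A : ℚ := ((u : ℤ) - c : ℚ) / ((q : ℤ) : ℚ) with hA
  set B : ℚ := ((u + X + 1 : ℤ) - c : ℚ) / ((q : ℤ) : ℚ) with hB
  have hqQ : (0 : ℚ) < ((q : ℤ) : ℚ) := by exact_mod_cast hq
  have hBA : B - A = ((X : ℚ) + 1) / q := by
    rw [hA, hB]
    push_cast
    field_simp
    ring
  have hAB : A ≤ B := by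
    have : (0 : ℚ) ≤ ((X : ℚ) + 1) / q := by positivity
    linarith
  have hmax : max (⌈B⌉ - ⌈A⌉) 0 = ⌈B⌉ - ⌈A⌉ :=
    max_eq_left (sub_nonneg.2 (Int.ceil_le_ceil hAB))
  rw [hmax] at h
  -- bounds in `ℚ`
  have h1 : (⌈B⌉ : ℚ) < B + 1 := Int.ceil_lt_add_one B
  have h2 : A ≤ (⌈A⌉ : ℚ) := Int.le_ceil A
  have h3 : B ≤ (⌈B⌉ : ℚ) := Int.le_ceil B
  have h4 : (⌈A⌉ : ℚ) < A + 1 := Int.ceil_lt_add_one A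
  have hcardQ : ((((Ico u (u + X + 1)).filter (fun x => Int.ModEq q x c)).card : ℕ) : ℚ) =
      (⌈B⌉ : ℚ) - ⌈A⌉ := by
    have : ((((Ico u (u + X + 1)).filter (fun x => Int.ModEq q x c)).card : ℕ) : ℤ) = ⌈B⌉ - ⌈A⌉ := h
    exact_mod_cast congrArg (fun z : ℤ => (z : ℚ)) this
  have hlowQ : ((X : ℚ) + 1) / q - 1 <
      ((((Ico u (u + X + 1)).filter (fun x => Int.ModEq q x c)).card : ℕ) : ℚ) := by
    rw [hcardQ]; linarith
  have hupQ : ((((Ico u (u + X + 1)).filter (fun x => Int.ModEq q x c)).card : ℕ) : ℚ) <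
      ((X : ℚ) + 1) / q + 1 := by
    rw [hcardQ]; linarith
  have hlowR := (Rat.cast_lt (K := ℝ)).2 hlowQ
  have hupR := (Rat.cast_lt (K := ℝ)).2 hupQ
  push_cast at hlowR hupR
  exact ⟨hlowR, hupR⟩

/-! ### The coset of a box -/

/-- `#(B ∩ (c + qℤ^t)) = ∏_i #{u_i ≤ x ≤ u_i + X_i : x ≡ c_i (q)}`. -/
theorem card_coset_box (u c : Fin t → ℤ) (X : Fin t → ℕ) (q : ℕ) :
    ((box u X).filter (fun b => ∀ i, Int.ModEq q (b i) (c i))).card =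
      ∏ i, ((Icc (u i) (u i + X i)).filter (fun x => Int.ModEq q x (c i))).card := by
  rw [box_filter_modEq, Fintype.card_piFinset]

/-- `(1 + r)^t ≤ 1 + t 2^t r` for `0 ≤ r ≤ 1`. -/
theorem one_add_pow_le_of_le_one {r : ℝ} (hr0 : 0 ≤ r) (hr1 : r ≤ 1) (t : ℕ) :
    (1 + r) ^ t ≤ 1 + t * 2 ^ t * r := by
  induction t with
  | zero => simp
  | succ n ih =>
    have h2 : (1 + r) ^ n ≤ 2 ^ n := pow_le_pow_left₀ (by linarith) (by linarith) n
    have h2n : (0 : ℝ) ≤ 2 ^ n := by positivity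
    calc (1 + r) ^ (n + 1) = (1 + r) ^ n + (1 + r) ^ n * r := by ring
      _ ≤ (1 + n * 2 ^ n * r) + 2 ^ n * r := by
          gcongr
      _ ≤ 1 + (n + 1 : ℕ) * 2 ^ (n + 1) * r := by
          push_cast
          rw [pow_succ]
          nlinarith [mul_nonneg h2n hr0, mul_nonneg (mul_nonneg (Nat.cast_nonneg n) h2n) hr0]

/-- Product perturbation: if `0 ≤ x_i` and `|m_i − x_i| ≤ r x_i` with `0 ≤ r ≤ 1`, then
`|∏ m_i − ∏ x_i| ≤ t 2^t r ∏ x_i`. -/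
theorem abs_prod_sub_prod_le {m x : Fin t → ℝ} {r : ℝ} (hr0 : 0 ≤ r) (hr1 : r ≤ 1)
    (hx : ∀ i, 0 ≤ x i) (hm : ∀ i, |m i - x i| ≤ r * x i) :
    |∏ i, m i - ∏ i, x i| ≤ t * 2 ^ t * r * ∏ i, x i := by
  have hP : 0 ≤ ∏ i, x i := Finset.prod_nonneg fun i _ => hx i
  have hm0 : ∀ i, 0 ≤ m i := by
    intro i
    have := (abs_le.1 (hm i)).1
    nlinarith [hx i, mul_nonneg hr0 (hx i)]
  have hup : ∏ i, m i ≤ (1 + r) ^ t * ∏ i, x i := by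
    calc ∏ i, m i ≤ ∏ i, (1 + r) * x i :=
          Finset.prod_le_prod (fun i _ => hm0 i) fun i _ => by
            have := (abs_le.1 (hm i)).2; linarith
      _ = (1 + r) ^ t * ∏ i, x i := by
          rw [Finset.prod_mul_distrib, Finset.prod_const, Finset.card_univ, Fintype.card_fin]
  have hlow : (1 - r) ^ t * ∏ i, x i ≤ ∏ i, m i := by
    calc (1 - r) ^ t * ∏ i, x i = ∏ i, (1 - r) * x i := by
          rw [Finset.prod_mul_distrib, Finset.prod_const, Finset.card_univ, Fintype.card_fin]
      _ ≤ ∏ i, m i :=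
          Finset.prod_le_prod (fun i _ => mul_nonneg (by linarith) (hx i)) fun i _ => by
            have := (abs_le.1 (hm i)).1; linarith
  have hbern : 1 - t * r ≤ (1 - r) ^ t := by
    have := one_add_mul_le_pow (a := -r) (by linarith) t
    rw [show (1 : ℝ) - r = 1 + -r by ring]
    linarith [this]
  have hpow := one_add_pow_le_of_le_one hr0 hr1 t
  have h2t : (1 : ℝ) ≤ 2 ^ t := one_le_pow₀ (by norm_num)
  rw [abs_le]
  constructor
  · -- lower: ∏ m − ∏ x ≥ ((1-r)^t − 1) ∏ x ≥ −t r ∏ x ≥ −t 2^t r ∏ x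
    have h1 : -(t * 2 ^ t * r * ∏ i, x i) ≤ -(t * r * ∏ i, x i) := by
      have : t * r * ∏ i, x i ≤ t * 2 ^ t * r * ∏ i, x i := by
        have := mul_le_mul_of_nonneg_right h2t (mul_nonneg (mul_nonneg (Nat.cast_nonneg t) hr0) hP)
        nlinarith [this]
      linarith
    refine le_trans h1 ?_
    have : (1 - t * r) * ∏ i, x i ≤ ∏ i, m i :=
      le_trans (mul_le_mul_of_nonneg_right hbern hP) hlow
    nlinarith [this]
  · have : ∏ i, m i ≤ (1 + t * 2 ^ t * r) * ∏ i, x i :=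
      le_trans hup (mul_le_mul_of_nonneg_right hpow hP)
    nlinarith [this]

/-- The size of a box-coset: `|#C − ∏_i (X_i+1)/q^t| ≤ t 2^t (q/D) ∏_i (X_i+1)/q^t` whenever
`1 ≤ q ≤ D ≤ X_i + 1` for all `i`. -/
theorem abs_card_coset_box_sub_le {q : ℕ} (hq : 0 < q) (u c : Fin t → ℤ) (X : Fin t → ℕ) {D : ℝ}
    (hqD : (q : ℝ) ≤ D) (hD : ∀ i, D ≤ (X i : ℝ) + 1) :
    |((((box u X).filter (fun b => ∀ i, Int.ModEq q (b i) (c i))).card : ℕ) : ℝ) -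
        (∏ i, ((X i : ℝ) + 1)) / (q : ℝ) ^ t| ≤
      t * 2 ^ t * ((q : ℝ) / D) * ((∏ i, ((X i : ℝ) + 1)) / (q : ℝ) ^ t) := by
  have hq0 : (0 : ℝ) < q := by exact_mod_cast hq
  have hD0 : 0 < D := lt_of_lt_of_le hq0 hqD
  have hprod : (∏ i, ((X i : ℝ) + 1)) / (q : ℝ) ^ t = ∏ i, (((X i : ℝ) + 1) / q) := by
    rw [Finset.prod_div_distrib, Finset.prod_const, Finset.card_univ, Fintype.card_fin]
  rw [card_coset_box, Nat.cast_prod, hprod]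
  refine abs_prod_sub_prod_le (r := (q : ℝ) / D) (by positivity) ((div_le_one hD0).2 hqD)
    (fun i => by positivity) fun i => ?_
  have hb := card_Icc_filter_modEq_bounds hq (u i) (c i) (X i)
  have hXD : ((q : ℝ) / D) * (((X i : ℝ) + 1) / q) ≥ 1 := by
    rw [ge_iff_le, div_mul_div_comm, one_le_div (by positivity)]
    nlinarith [hD i, hq0]
  rw [abs_le]
  constructor <;> linarith [hb.1, hb.2]

/-- A box-coset has at most `2 ∏_i (X_i+1)/q^t` points once `2 t 2^t q ≤ D ≤ X_i + 1`. -/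
theorem card_coset_box_le_two_mul {q : ℕ} (hq : 0 < q) (u c : Fin t → ℤ) (X : Fin t → ℕ) {D : ℝ}
    (hqD : 2 * t * 2 ^ t * (q : ℝ) ≤ D) (hqD' : (q : ℝ) ≤ D) (hD : ∀ i, D ≤ (X i : ℝ) + 1) :
    ((((box u X).filter (fun b => ∀ i, Int.ModEq q (b i) (c i))).card : ℕ) : ℝ) ≤
      2 * ((∏ i, ((X i : ℝ) + 1)) / (q : ℝ) ^ t) := by
  have hq0 : (0 : ℝ) < q := by exact_mod_cast hq
  have hD0 : 0 < D := lt_of_lt_of_le hq0 hqD'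
  have h := abs_card_coset_box_sub_le hq u c X hqD' hD
  have hP : 0 ≤ (∏ i, ((X i : ℝ) + 1)) / (q : ℝ) ^ t := by positivity
  have hcoef : t * 2 ^ t * ((q : ℝ) / D) ≤ 1 := by
    rw [← mul_div_assoc, div_le_one hD0]
    nlinarith [hqD, hq0]
  have := (abs_le.1 h).2
  nlinarith [mul_le_mul_of_nonneg_right hcoef hP]

/-! ### The window count -/

/-- `#{n < W : ∀ i, gcd(a_i n + c_i, q) = 1} = W/q · #{r < q : ∀ i, gcd(a_i r + c_i, q) = 1} ± q`. -/
theorem abs_card_window_coprime_sub_le {q : ℕ} (hq : 0 < q) (a c : Fin t → ℤ) (W : ℕ) :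
    |((((Finset.range W).filter (fun n : ℕ => ∀ i, Int.gcd (a i * n + c i) q = 1)).card : ℕ) : ℝ) -
        (W : ℝ) / q *
          ((((Finset.range q).filter (fun r : ℕ => ∀ i, Int.gcd (a i * r + c i) q = 1)).card : ℕ) : ℝ)|
      ≤ q := by
  set P : ℕ → Prop := fun r => ∀ i, Int.gcd (a i * r + c i) q = 1 with hP
  set k := W / q with hk
  have hW : q * k ≤ W := Nat.mul_div_le W q
  have hWlt : W < q * k + q := by
    have := Nat.lt_mul_div_succ W hq
    rw [hk]; linarith [this]
  -- the predicate only depends on `n mod q`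
  have hper : ∀ n : ℕ, P n ↔ P (n % q) := by
    intro n
    refine forall_congr' fun i => ?_
    rw [int_gcd_linear_mod (dvd_refl q)]
  have hsplit : (Finset.range W).filter P =
      (Finset.range (q * k)).filter P ∪ ((Finset.range W) \ Finset.range (q * k)).filter P := by
    rw [← filter_union]
    congr 1
    ext n
    simp only [mem_union, mem_range, Finset.mem_sdiff]
    omega
  have hdisj : Disjoint ((Finset.range (q * k)).filter P)
      (((Finset.range W) \ Finset.range (q * k)).filter P) := by
    rw [Finset.disjoint_left]
    intro n hn hn'
    rw [mem_filter, mem_range] at hn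
    rw [mem_filter, Finset.mem_sdiff, mem_range, mem_range] at hn'
    omega
  have hmain : ((Finset.range (q * k)).filter P).card = k * ((Finset.range q).filter P).card := by
    rw [← card_filter_range_mul_periodic hq k P]
    congr 1
    exact Finset.filter_congr fun n _ => hper n
  have hrest : (((Finset.range W) \ Finset.range (q * k)).filter P).card ≤ q := by
    calc (((Finset.range W) \ Finset.range (q * k)).filter P).card
        ≤ ((Finset.range W) \ Finset.range (q * k)).card := Finset.card_filter_le _ _
      _ = W - q * k := by rw [Finset.card_sdiff_of_subset (Finset.range_subset_range.2 hW), card_range, card_range]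
      _ ≤ q := by omega
  have hcard : ((Finset.range W).filter P).card =
      k * ((Finset.range q).filter P).card + (((Finset.range W) \ Finset.range (q * k)).filter P).card := by
    rw [hsplit, card_union_of_disjoint hdisj, hmain]
  have hcq : ((Finset.range q).filter P).card ≤ q := by
    calc ((Finset.range q).filter P).card ≤ (Finset.range q).card := Finset.card_filter_le _ _
      _ = q := card_range q
  -- real arithmetic
  have hq0 : (0 : ℝ) < q := by exact_mod_cast hq
  have hkR : (W : ℝ) / q - 1 ≤ (k : ℝ) ∧ (k : ℝ) ≤ (W : ℝ) / q := by
    constructor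
    · rw [div_sub_one hq0.ne', div_le_iff₀ hq0]
      have : (W : ℝ) < q * k + q := by exact_mod_cast hWlt
      linarith
    · rw [le_div_iff₀ hq0]
      have : (q : ℝ) * k ≤ W := by exact_mod_cast hW
      linarith
  have hcardR : ((((Finset.range W).filter P).card : ℕ) : ℝ) =
      (k : ℝ) * ((((Finset.range q).filter P).card : ℕ) : ℝ) +
        (((((Finset.range W) \ Finset.range (q * k)).filter P).card : ℕ) : ℝ) := by
    rw [hcard]; push_cast; ring
  have hrestR : (((((Finset.range W) \ Finset.range (q * k)).filter P).card : ℕ) : ℝ) ≤ q := by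
    exact_mod_cast hrest
  have hcqR : ((((Finset.range q).filter P).card : ℕ) : ℝ) ≤ q := by exact_mod_cast hcq
  have hcq0 : (0 : ℝ) ≤ ((((Finset.range q).filter P).card : ℕ) : ℝ) := Nat.cast_nonneg _
  have hrest0 : (0 : ℝ) ≤ (((((Finset.range W) \ Finset.range (q * k)).filter P).card : ℕ) : ℝ) :=
    Nat.cast_nonneg _
  rw [hcardR, abs_le]
  constructor
  · nlinarith [hkR.1, hkR.2]
  · nlinarith [hkR.1, hkR.2]

/-- Registered form of `abs_card_window_coprime_sub_le` (aux for `stub_inversion`). -/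
theorem window_coprime_count : ∀ {t : ℕ} (q : ℕ), 0 < q → ∀ (a c : Fin t → ℤ) (W : ℕ), |((((Finset.range W).filter (fun n : ℕ => ∀ i, Int.gcd (a i * n + c i) q = 1)).card : ℕ) : ℝ) - (W : ℝ) / q * ((((Finset.range q).filter (fun r : ℕ => ∀ i, Int.gcd (a i * r + c i) q = 1)).card : ℕ) : ℝ)| ≤ q :=
  fun _ hq a c W => abs_card_window_coprime_sub_le hq a c W

/-! ### `MovingClassMoments` with the window count over `ℕ`

In `MovingClassMoments` the window count `#{n < W : ∀ i, gcd(a_i n + c_i, q) = 1}` is elaborated with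
`n : ℤ` ranging over the monadic image of `Finset.range W` in `Finset ℤ`; we convert it to the count
over `n : ℕ` used in this line. -/

/-- The monadic image of `range W` in `ℤ`, filtered, has the same size as `range W` filtered. -/
theorem card_filter_range_bind_pure (W : ℕ) (P : ℤ → Prop) [DecidablePred P] :
    (((Finset.range W) >>= fun n : ℕ => (pure (n : ℤ) : Finset ℤ)).filter P).card =
      ((Finset.range W).filter (fun n : ℕ => P n)).card := by
  simp only [Finset.bind_def, Finset.pure_def]
  symm
  refine Finset.card_nbij' (fun n : ℕ => (n : ℤ)) (fun x : ℤ => x.toNat) ?_ ?_ ?_ ?_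
  · intro n hn
    simp only [Finset.mem_coe, Finset.mem_filter, Finset.mem_range] at hn
    simp only [Finset.mem_coe, Finset.mem_filter, Finset.mem_sup, Finset.mem_singleton,
      Finset.mem_range]
    exact ⟨⟨n, hn.1, rfl⟩, hn.2⟩
  · intro x hx
    simp only [Finset.mem_coe, Finset.mem_filter, Finset.mem_sup, Finset.mem_singleton,
      Finset.mem_range] at hx
    obtain ⟨⟨n, hn, rfl⟩, hP⟩ := hx
    simp only [Finset.mem_coe, Finset.mem_filter, Finset.mem_range, Int.toNat_natCast]
    exact ⟨hn, hP⟩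
  · intro n _
    simp
  · intro x hx
    simp only [Finset.mem_coe, Finset.mem_filter, Finset.mem_sup, Finset.mem_singleton,
      Finset.mem_range] at hx
    obtain ⟨⟨n, _, rfl⟩, _⟩ := hx
    simp

/-- `MovingClassMoments θ₁` restated with the window count over `n : ℕ`. -/
theorem movingClassMoments_nat {θ₁ : ℝ} (h : MovingClassMoments θ₁) :
    ∀ (t L : ℕ), 1 ≤ t → ∀ δ ε : ℝ, 0 < δ → 0 < ε → ∃ N₀ : ℕ, ∀ N : ℕ, N₀ ≤ N →
      ∀ q : ℕ, 1 ≤ q → (q : ℝ) ≤ (N : ℝ) ^ θ₁ →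
        ∀ a c u : Fin t → ℤ, (∀ i, a i ≠ 0 ∧ |a i| ≤ L) →
          ∀ X : Fin t → ℕ, (∀ i, δ * N ≤ (X i : ℝ)) →
            ∀ W : ℕ, δ * N ≤ W →
              (∀ i, ∀ n : ℕ, n < W →
                δ * N + 1 ≤ ((a i * n + u i : ℤ) : ℝ) ∧ ((a i * n + u i + X i : ℤ) : ℝ) ≤ L * N) →
              |(∑ n ∈ Finset.range W,
                  ∏ i, (classPsi (a i * n + u i + X i).toNat q (resid q (a i * n + c i))
                        - classPsi (a i * n + u i - 1).toNat q (resid q (a i * n + c i))))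
                - (∏ i, ((X i : ℝ) + 1)) / (Nat.totient q : ℝ) ^ t *
                    (((Finset.range W).filter
                      (fun n : ℕ => ∀ i, Int.gcd (a i * n + c i) q = 1)).card : ℝ)|
                ≤ ε * W * (∏ i, ((X i : ℝ) + 1)) / (Nat.totient q : ℝ) ^ t := by
  intro t L ht δ ε hδ hε
  obtain ⟨N₀, hN₀⟩ := h t L ht δ ε hδ hε
  refine ⟨N₀, fun N hN q hq hqN a c u ha X hX W hW hpos => ?_⟩
  have := hN₀ N hN q hq hqN a c u ha X hX W hW hpos
  rwa [card_filter_range_bind_pure W (fun n : ℤ => ∀ i, Int.gcd (a i * n + c i) q = 1)] at this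

/-! ### The crude bound for a window sum -/

/-- `Λ(x.toNat) ≤ log M` whenever `|x| ≤ M` and `1 ≤ M`. -/
theorem vonMangoldt_toNat_le_log {x : ℤ} {M : ℝ} (hM : 1 ≤ M) (hx : |(x : ℝ)| ≤ M) :
    Λ x.toNat ≤ Real.log M := by
  rcases Nat.eq_zero_or_pos x.toNat with h0 | hpos
  · rw [h0, ArithmeticFunction.map_zero]
    exact Real.log_nonneg hM
  · calc Λ x.toNat ≤ Real.log (x.toNat : ℝ) := ArithmeticFunction.vonMangoldt_le_log
      _ ≤ Real.log M := by
          apply Real.log_le_log (by exact_mod_cast hpos)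
          have h1 : ((x.toNat : ℕ) : ℝ) = ((x.toNat : ℤ) : ℝ) := by norm_cast
          have h2 : (x.toNat : ℤ) = x := Int.toNat_of_nonneg (by omega)
          rw [h1, h2]
          exact le_trans (le_abs_self _) hx

/-- Crude bound: if `|a_i n + b_i| ≤ M` (`M ≥ 1`) for all `i` and `n < W`, then
`Σ_{n<W} ∏_i Λ(a_i n + b_i) ≤ W (log M)^t`. -/
theorem window_sum_le (a b : Fin t → ℤ) (W : ℕ) {M : ℝ} (hM : 1 ≤ M)
    (hb : ∀ i, ∀ n : ℕ, n < W → |((a i * n + b i : ℤ) : ℝ)| ≤ M) :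
    ∑ n ∈ Finset.range W, ∏ i, Λ ((a i * n + b i).toNat) ≤ W * Real.log M ^ t := by
  calc ∑ n ∈ Finset.range W, ∏ i, Λ ((a i * n + b i).toNat)
      ≤ ∑ n ∈ Finset.range W, Real.log M ^ t := by
        refine Finset.sum_le_sum fun n hn => ?_
        calc ∏ i, Λ ((a i * n + b i).toNat) ≤ ∏ i : Fin t, Real.log M :=
              Finset.prod_le_prod (fun i _ => ArithmeticFunction.vonMangoldt_nonneg)
                fun i _ => vonMangoldt_toNat_le_log hM (hb i n (Finset.mem_range.1 hn))
          _ = Real.log M ^ t := by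
              rw [Finset.prod_const, Finset.card_univ, Fintype.card_fin]
    _ = W * Real.log M ^ t := by
        rw [Finset.sum_const, card_range, nsmul_eq_mul]

/-- The window sum is non-negative. -/
theorem window_sum_nonneg (a b : Fin t → ℤ) (W : ℕ) :
    0 ≤ ∑ n ∈ Finset.range W, ∏ i, Λ ((a i * n + b i).toNat) :=
  Finset.sum_nonneg fun _ _ => Finset.prod_nonneg fun _ _ => ArithmeticFunction.vonMangoldt_nonneg

end Summit.Parity.GeneralizedHardyLittlewood.Cruxes.RelativeDimOne.GallagherBackwardsSplit
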